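import Summits.HubbardSuperconductivity.HubbardSuperconductivity.Theorems.WcbcsSsbToTorusLRO.Negative.SummitMatrixUniformFloor
import Summits.HubbardSuperconductivity.HubbardSuperconductivity.Theorems.WcbcsSsbToTorusLRO.Negative.BlockRepulsionDominatesPairOrder
import Summits.HubbardSuperconductivity.HubbardSuperconductivity.Theorems.WeakCouplingBCSWcbcsSsbToTorusLROFejerClosure
import Summits.HubbardSuperconductivity.HubbardSuperconductivity.Theorems.BalabanIRBirEveryGroundStateSchur

/-!
# Crux `WcbcsSsbToTorusLRO` (item `stmt-HubbardSuperconductivity-2009`): the promoted stub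
`stub_facePurityChord` of line `tangent-face-legendre-spine`, DISSECTED — negative-side support from the standing
disprover (generation 4), file 3 of 4

Route `WeakCouplingBCS`, crux rank 2. The lead's v2 skeleton closes the crux from ONE open stub
`stub_facePurityChord` — a CHORD statement about the `(N_L, S^z = 0)`-sector energy of the Kac-block-REPELLED
torus `hubbardTorus 2 L 1 U + κ W_R` (`W_R = R⁻⁴ Σ_a B_aᴴ B_a`, file 2) — plus item stmt-1089 and the landed Fejér
closure (`Theorems/WeakCouplingBCSWcbcsSsbToTorusLROFejerClosure.lean`). On the literal terms of the stub
(`stubFacePurityChord_iff` below is `Iff.rfl`; CHORD / DERIVATIVE / FLOOR / LEAK at `(U, δ)` name the four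
statements displayed in the theorems, all written out on the literal route terms; no definitions):

* `deriv_of_chord` — chord ⇒ DERIVATIVE (every-ground-state) face purity: one `a > 0` with
  `re⟨ψ, W_R ψ⟩ ≥ a L²` for every normalised sector ground state, every scale `R`, eventually in the even side
  (Danskin in the repulsive direction, tree `chord_div_le_re_expect_of_eigen`);
* `deriv_of_floor`, `deriv_of_hasDWavePairFieldLROAt` (`δ ≥ 0`) — by file 2 (`re⟨P†P⟩ ≤ L² re⟨W_R⟩`) and
  file 1 (the summit matrix is the pair-order floor), the every-GS block-coherence floor at ALL scales is
  NECESSARY for the crux's conclusion: the derivative form is not an independent bet;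
* `floor_of_deriv_of_leak`, `deriv_iff_hasDWavePairFieldLROAt_of_leak` — conversely, with the pointwise
  infrared LEAK at `(U, δ)` (what the line takes from stmt-1089, file 4) and the landed Fejér closure, the
  derivative form gives back the floor: MODULO the leak, derivative face purity IS the summit matrix at
  `(U, δ)` — the line reduces nothing at the derivative level;
* `extensiveGap_of_chord` — the chord's entire excess over the derivative form: for every scale `R` a coupling
  `κ = κ(R) > 0`, INDEPENDENT of the side, such that every unit vector of the sector with block coherence
  `≤ (a/2)L²` has energy `≥ E_sec + (κa/2)L²` (order-poor states are extensively excited: no order-poor state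
  is degenerate in energy DENSITY with the ground state — face purity proper, read off two sector ENERGIES, which
  is why the card bets on it; it does not require the order to survive the repulsion, since `κ(R)` may be taken
  below the condensation-energy scale, and it is strictly more than the crux asks);
* `stub_gives_deriv` — packaging on the registered signature.

Folklore bookkeeping over the finite-dimensional variational principle (Tasaki 2020 §2.1–2.2); the chord
inequality is reused from `Theorems/BalabanIRBirEveryGroundStateSchur.lean`. Workfile:
`Cruxes/WcbcsSsbToTorusLRO/Disproof.lean` §15 (same statements with named definitions).
-/

noncomputable section

namespace Summit.HubbardSuperconductivity.WcbcsSsbToTorusLRO.Negative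

open Matrix Literature.MathematicalPhysics.QuantumLattice Literature.Barriers.HubbardSuperconductivity
open Summit.HubbardSuperconductivity.HubbardSuperconductivity.Theorems
  (chord_div_le_re_expect_of_eigen minEnergyOn_le_re_rayleigh)
open Filter Set
open scoped Matrix ComplexOrder Matrix.Norms.L2Operator
open _root_.Topology

/-! ### The stub, literally -/

/-- The registered stub `stub_facePurityChord` of line `tangent-face-legendre-spine` IS
`crux hypotheses → CHORD(U, δ)` (definitional; the left side is the registered signature verbatim, the right side
displays CHORD). [folklore] -/
theorem stubFacePurityChord_iff :
    (∃ U₀ : ℝ, 0 < U₀ ∧ ∀ U ∈ Set.Ioo (0:ℝ) U₀, ∀ δ ∈ Set.Ioo (0:ℝ) (1 / 2), ∀ μ : ℝ, Filter.Tendsto (fun L : ℕ => ((hubbardTorusWith 2 (L + 1) 1 U μ).groundStateFunctional totalNumber).re / ((L + 1 : ℕ) : ℝ) ^ 2) Filter.atTop (nhds (1 - δ)) → HasDWaveOrder U μ → ∃ a : ℝ, 0 < a ∧ ∀ R : ℕ, 0 < R → ∃ κ : ℝ, 0 < κ ∧ ∀ᶠ k : ℕ in Filter.atTop, κ * a * ((2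 * k + 1 + 1 : ℕ) : ℝ) ^ 2 ≤ (hubbardTorus 2 (2 * k + 1 + 1) 1 U + (κ : ℂ) • ((((R : ℝ) ^ 4)⁻¹ : ℝ) : ℂ) • ∑ a : Literature.Probability.LatticeModels.TorusSite 2 (2 * k + 1 + 1), (∑ u : Fin 2 → Fin R, localPair dWaveFormFactor (2 * k + 1 + 1) (a + fun i => ((u i : ℕ) : ZMod (2 * k + 1 + 1))))ᴴ * (∑ u : Fin 2 → Fin R, localPair dWaveFormFactor (2 * k + 1 + 1) (a + fun i => ((u i : ℕ) : ZMod (2 * k + 1 + 1))))).minEnergyOn (szSector (2 * ⌊(1 - δ) * ((2 * k + 1 + 1 : ℕ) : ℝ) ^ 2 / 2⌋₊) 0) - (hubbardTorus 2 (2 * k + 1 + 1) 1 U).minEnergyOn (szSector (2 * ⌊(1 - δ) * ((2 * k + 1 + 1 : ℕ) : ℝ) ^ 2 / 2⌋₊) 0)) ↔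
    (∃ U₀ : ℝ, 0 < U₀ ∧ ∀ U ∈ Set.Ioo (0:ℝ) U₀, ∀ δ ∈ Set.Ioo (0:ℝ) (1 / 2), ∀ μ : ℝ,
      Filter.Tendsto (fun L : ℕ => ((hubbardTorusWith 2 (L + 1) 1 U μ).groundStateFunctional totalNumber).re /
        ((L + 1 : ℕ) : ℝ) ^ 2) Filter.atTop (nhds (1 - δ)) → HasDWaveOrder U μ → (∃ a : ℝ, 0 < a ∧ ∀ R : ℕ, 0 < R → ∃ κ : ℝ, 0 < κ ∧ ∀ᶠ k : ℕ in Filter.atTop,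
    κ * a * ((2 * k + 1 + 1 : ℕ) : ℝ) ^ 2 ≤
      (hubbardTorus 2 (2 * k + 1 + 1) 1 U + (κ : ℂ) • (((((R : ℝ) ^ 4)⁻¹ : ℝ) : ℂ) • ∑ a : Literature.Probability.LatticeModels.TorusSite 2 (2 * k + 1 + 1), ((∑ u : Fin 2 → Fin R, localPair dWaveFormFactor ((2 * k + 1 + 1)) (a + fun i => ((u i : ℕ) : ZMod ((2 * k + 1 + 1))))))ᴴ * ((∑ u : Fin 2 → Fin R, localPair dWaveFormFactor ((2 * k + 1 + 1)) (a + fun i => ((u i : ℕ) : ZMod ((2 * k + 1 + 1)))))))).minEnergyOn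
          (szSector (2 * ⌊(1 - δ) * (((2 * k + 1 + 1) : ℕ) : ℝ) ^ 2 / 2⌋₊) 0) -
        (hubbardTorus 2 (2 * k + 1 + 1) 1 U).minEnergyOn (szSector (2 * ⌊(1 - δ) * (((2 * k + 1 + 1) : ℕ) : ℝ) ^ 2 / 2⌋₊) 0))) :=
  Iff.rfl

/-! ### (1) Chord ⇒ derivative -/

/-- **Chord ⇒ derivative face purity** (Danskin in the repulsive direction: the penalised sector energy is at most
`E_sec + κ re⟨ψ, W_R ψ⟩` for every sector ground state `ψ`). [folklore] -/
theorem deriv_of_chord {U δ : ℝ} (h : (∃ a : ℝ, 0 < a ∧ ∀ R : ℕ, 0 < R → ∃ κ : ℝ, 0 < κ ∧ ∀ᶠ k : ℕ in Filter.atTop,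
    κ * a * ((2 * k + 1 + 1 : ℕ) : ℝ) ^ 2 ≤
      (hubbardTorus 2 (2 * k + 1 + 1) 1 U + (κ : ℂ) • (((((R : ℝ) ^ 4)⁻¹ : ℝ) : ℂ) • ∑ a : Literature.Probability.LatticeModels.TorusSite 2 (2 * k + 1 + 1), ((∑ u : Fin 2 → Fin R, localPair dWaveFormFactor ((2 * k + 1 + 1)) (a + fun i => ((u i : ℕ) : ZMod ((2 * k + 1 + 1))))))ᴴ * ((∑ u : Fin 2 → Fin R, localPair dWaveFormFactor ((2 * k + 1 + 1)) (a + fun i => ((u i : ℕ) : ZMod ((2 * k + 1 + 1)))))))).minEnergyOn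
          (szSector (2 * ⌊(1 - δ) * (((2 * k + 1 + 1) : ℕ) : ℝ) ^ 2 / 2⌋₊) 0) -
        (hubbardTorus 2 (2 * k + 1 + 1) 1 U).minEnergyOn (szSector (2 * ⌊(1 - δ) * (((2 * k + 1 + 1) : ℕ) : ℝ) ^ 2 / 2⌋₊) 0))) : (∃ a : ℝ, 0 < a ∧ ∀ R : ℕ, 0 < R → ∀ᶠ k : ℕ in Filter.atTop,
    ∀ ψ : Fock (Orb (FermionTorus 2 (2 * k + 1 + 1))),
      IsGroundStateInSector (hubbardTorus 2 (2 * k + 1 + 1) 1 U) (2 * ⌊(1 - δ) * (((2 * k + 1 + 1) : ℕ) : ℝ) ^ 2 / 2⌋₊) 0 ψ → star ψ ⬝ᵥ ψ = 1 →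
        a * ((2 * k + 1 + 1 : ℕ) : ℝ) ^ 2 ≤ (star ψ ⬝ᵥ ((((((R : ℝ) ^ 4)⁻¹ : ℝ) : ℂ) • ∑ a : Literature.Probability.LatticeModels.TorusSite 2 (2 * k + 1 + 1), ((∑ u : Fin 2 → Fin R, localPair dWaveFormFactor ((2 * k + 1 + 1)) (a + fun i => ((u i : ℕ) : ZMod ((2 * k + 1 + 1))))))ᴴ * ((∑ u : Fin 2 → Fin R, localPair dWaveFormFactor ((2 * k + 1 + 1)) (a + fun i => ((u i : ℕ) : ZMod ((2 * k + 1 + 1)))))))) *ᵥ ψ).re) := by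
  obtain ⟨a, ha, h⟩ := h
  refine ⟨a, ha, fun R hR => ?_⟩
  obtain ⟨κ, hκ, hk⟩ := h R hR
  filter_upwards [hk] with k hk
  intro ψ hψ hψ1
  have hchord := chord_div_le_re_expect_of_eigen (hubbardTorus 2 (2 * k + 1 + 1) 1 U) ((((((R : ℝ) ^ 4)⁻¹ : ℝ) : ℂ) • ∑ a : Literature.Probability.LatticeModels.TorusSite 2 (2 * k + 1 + 1), ((∑ u : Fin 2 → Fin R, localPair dWaveFormFactor ((2 * k + 1 + 1)) (a + fun i => ((u i : ℕ) : ZMod ((2 * k + 1 + 1))))))ᴴ * ((∑ u : Fin 2 → Fin R, localPair dWaveFormFactor ((2 * k + 1 + 1)) (a + fun i => ((u i : ℕ) : ZMod ((2 * k + 1 + 1))))))))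
    (szSector (2 * ⌊(1 - δ) * (((2 * k + 1 + 1) : ℕ) : ℝ) ^ 2 / 2⌋₊) 0) hκ hψ.1 hψ1 hψ.2.2
  rw [div_le_iff₀ hκ] at hchord
  have : κ * (a * ((2 * k + 1 + 1 : ℕ) : ℝ) ^ 2) ≤ κ * (star ψ ⬝ᵥ (((((R : ℝ) ^ 4)⁻¹ : ℝ) : ℂ) • ∑ a : Literature.Probability.LatticeModels.TorusSite 2 (2 * k + 1 + 1), ((∑ u : Fin 2 → Fin R, localPair dWaveFormFactor ((2 * k + 1 + 1)) (a + fun i => ((u i : ℕ) : ZMod ((2 * k + 1 + 1))))))ᴴ * ((∑ u : Fin 2 → Fin R, localPair dWaveFormFactor ((2 * k + 1 + 1)) (a + fun i => ((u i : ℕ) : ZMod ((2 * k + 1 + 1))))))) *ᵥ ψ).re := by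
    nlinarith
  exact le_of_mul_le_mul_left this hκ

/-! ### (2) The summit matrix forces the derivative form -/

/-- **Floor ⇒ derivative face purity** (same constant, every scale `R ≥ 1`; file 2). [folklore] -/
theorem deriv_of_floor {U δ : ℝ} (h : (∃ a : ℝ, 0 < a ∧ ∀ᶠ k : ℕ in Filter.atTop, ∀ ψ : Fock (Orb (FermionTorus 2 (2 * k + 1 + 1))),
    IsGroundStateInSector (hubbardTorus 2 (2 * k + 1 + 1) 1 U) (2 * ⌊(1 - δ) * (((2 * k + 1 + 1) : ℕ) : ℝ) ^ 2 / 2⌋₊) 0 ψ → star ψ ⬝ᵥ ψ = 1 →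
      a * ((2 * k + 1 + 1 : ℕ) : ℝ) ^ 4 ≤ (expect ((pairField dWaveFormFactor (2 * k + 1 + 1))ᴴ * pairField dWaveFormFactor (2 * k + 1 + 1)) ψ).re)) : (∃ a : ℝ, 0 < a ∧ ∀ R : ℕ, 0 < R → ∀ᶠ k : ℕ in Filter.atTop,
    ∀ ψ : Fock (Orb (FermionTorus 2 (2 * k + 1 + 1))),
      IsGroundStateInSector (hubbardTorus 2 (2 * k + 1 + 1) 1 U) (2 * ⌊(1 - δ) * (((2 * k + 1 + 1) : ℕ) : ℝ) ^ 2 / 2⌋₊) 0 ψ → star ψ ⬝ᵥ ψ = 1 →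
        a * ((2 * k + 1 + 1 : ℕ) : ℝ) ^ 2 ≤ (star ψ ⬝ᵥ ((((((R : ℝ) ^ 4)⁻¹ : ℝ) : ℂ) • ∑ a : Literature.Probability.LatticeModels.TorusSite 2 (2 * k + 1 + 1), ((∑ u : Fin 2 → Fin R, localPair dWaveFormFactor ((2 * k + 1 + 1)) (a + fun i => ((u i : ℕ) : ZMod ((2 * k + 1 + 1))))))ᴴ * ((∑ u : Fin 2 → Fin R, localPair dWaveFormFactor ((2 * k + 1 + 1)) (a + fun i => ((u i : ℕ) : ZMod ((2 * k + 1 + 1)))))))) *ᵥ ψ).re) := by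
  obtain ⟨a, ha, h⟩ := h
  refine ⟨a, ha, fun R hR => ?_⟩
  filter_upwards [h] with k hk
  intro ψ hψ hψ1
  have h1 := hk ψ hψ hψ1
  have h2 := re_expect_pairIntensity_le_sq_mul_blockRepulsion (2 * k + 1 + 1) R hR ψ
  have hL : (0 : ℝ) < ((2 * k + 1 + 1 : ℕ) : ℝ) ^ 2 := by positivity
  have h3 : a * ((2 * k + 1 + 1 : ℕ) : ℝ) ^ 4 ≤
      ((2 * k + 1 + 1 : ℕ) : ℝ) ^ 2 * (star ψ ⬝ᵥ (((((R : ℝ) ^ 4)⁻¹ : ℝ) : ℂ) • ∑ a : Literature.Probability.LatticeModels.TorusSite 2 (2 * k + 1 + 1), ((∑ u : Fin 2 → Fin R, localPair dWaveFormFactor ((2 * k + 1 + 1)) (a + fun i => ((u i : ℕ) : ZMod ((2 * k + 1 + 1))))))ᴴ * ((∑ u : Fin 2 → Fin R, localPair dWaveFormFactor ((2 * k + 1 + 1)) (a + fun i => ((u i : ℕ) : ZMod ((2 * k + 1 + 1))))))) *ᵥ ψ).re := h1.trans h2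
  have e : a * ((2 * k + 1 + 1 : ℕ) : ℝ) ^ 4 = ((2 * k + 1 + 1 : ℕ) : ℝ) ^ 2 * (a * ((2 * k + 1 + 1 : ℕ) : ℝ) ^ 2) := by
    ring
  rw [e] at h3
  exact le_of_mul_le_mul_left h3 hL

/-- **The summit matrix at `(U, δ)` forces derivative face purity** (`δ ≥ 0`): the every-GS block-coherence floor
at all scales is NECESSARY for the crux's conclusion. [folklore] -/
theorem deriv_of_hasDWavePairFieldLROAt {U δ : ℝ} (hδ : 0 ≤ δ) (h : HasDWavePairFieldLROAt U δ) : (∃ a : ℝ, 0 < a ∧ ∀ R : ℕ, 0 < R → ∀ᶠ k : ℕ in Filter.atTop,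
    ∀ ψ : Fock (Orb (FermionTorus 2 (2 * k + 1 + 1))),
      IsGroundStateInSector (hubbardTorus 2 (2 * k + 1 + 1) 1 U) (2 * ⌊(1 - δ) * (((2 * k + 1 + 1) : ℕ) : ℝ) ^ 2 / 2⌋₊) 0 ψ → star ψ ⬝ᵥ ψ = 1 →
        a * ((2 * k + 1 + 1 : ℕ) : ℝ) ^ 2 ≤ (star ψ ⬝ᵥ ((((((R : ℝ) ^ 4)⁻¹ : ℝ) : ℂ) • ∑ a : Literature.Probability.LatticeModels.TorusSite 2 (2 * k + 1 + 1), ((∑ u : Fin 2 → Fin R, localPair dWaveFormFactor ((2 * k + 1 + 1)) (a + fun i => ((u i : ℕ) : ZMod ((2 * k + 1 + 1))))))ᴴ * ((∑ u : Fin 2 → Fin R, localPair dWaveFormFactor ((2 * k + 1 + 1)) (a + fun i => ((u i : ℕ) : ZMod ((2 * k + 1 + 1)))))))) *ᵥ ψ).re) :=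
  deriv_of_floor (floor_of_hasDWavePairFieldLROAt hδ h)

/-! ### (3) Derivative face purity + infrared leak ⇒ the floor (landed Fejér closure) -/

/-- A block scale making the Fejér UV tail small: `2π²C²/(R²η²) ≤ a/4` for some `R ≥ 1`. [folklore] -/
theorem exists_blockScale (C : ℝ) {a η : ℝ} (ha : 0 < a) (hη : 0 < η) :
    ∃ R : ℕ, 0 < R ∧ 2 * Real.pi ^ 2 * C ^ 2 / ((R : ℝ) ^ 2 * η ^ 2) ≤ a / 4 := by
  obtain ⟨R, hR⟩ := exists_nat_gt (max (8 * Real.pi ^ 2 * C ^ 2 / (a * η ^ 2)) 1)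
  have hR1 : (1 : ℝ) < R := lt_of_le_of_lt (le_max_right _ _) hR
  have hRX : 8 * Real.pi ^ 2 * C ^ 2 / (a * η ^ 2) < R := lt_of_le_of_lt (le_max_left _ _) hR
  have hRpos : 0 < R := by exact_mod_cast (zero_lt_one.trans hR1)
  refine ⟨R, hRpos, ?_⟩
  have hR2 : (R : ℝ) ≤ (R : ℝ) ^ 2 := by nlinarith
  have hX : 8 * Real.pi ^ 2 * C ^ 2 ≤ a * η ^ 2 * (R : ℝ) ^ 2 := by
    rw [div_lt_iff₀ (by positivity)] at hRX
    nlinarith [mul_pos ha (pow_pos hη 2)]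
  rw [div_le_div_iff₀ (by positivity) (by norm_num : (0:ℝ) < 4)]
  nlinarith

/-- **Derivative face purity + infrared leak ⇒ uniform floor**, through the LANDED Fejér closure
`Theorems.WcbcsSsbToTorusLRO.stub_fejerClosure` (leak budget `a/4`, tail `≤ a/4`, floor `a/2`). [folklore] -/
theorem floor_of_deriv_of_leak {U δ : ℝ} (hP : (∃ a : ℝ, 0 < a ∧ ∀ R : ℕ, 0 < R → ∀ᶠ k : ℕ in Filter.atTop,
    ∀ ψ : Fock (Orb (FermionTorus 2 (2 * k + 1 + 1))),
      IsGroundStateInSector (hubbardTorus 2 (2 * k + 1 + 1) 1 U) (2 * ⌊(1 - δ) * (((2 * k + 1 + 1) : ℕ) : ℝ) ^ 2 / 2⌋₊) 0 ψ → star ψ ⬝ᵥ ψ = 1 →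
        a * ((2 * k + 1 + 1 : ℕ) : ℝ) ^ 2 ≤ (star ψ ⬝ᵥ ((((((R : ℝ) ^ 4)⁻¹ : ℝ) : ℂ) • ∑ a : Literature.Probability.LatticeModels.TorusSite 2 (2 * k + 1 + 1), ((∑ u : Fin 2 → Fin R, localPair dWaveFormFactor ((2 * k + 1 + 1)) (a + fun i => ((u i : ℕ) : ZMod ((2 * k + 1 + 1))))))ᴴ * ((∑ u : Fin 2 → Fin R, localPair dWaveFormFactor ((2 * k + 1 + 1)) (a + fun i => ((u i : ℕ) : ZMod ((2 * k + 1 + 1)))))))) *ᵥ ψ).re)) (hIR : (∀ b : ℝ, 0 < b → ∃ η : ℝ, 0 < η ∧ ∀ᶠ k : ℕ in Filter.atTop,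
    ∀ ψ : Fock (Orb (FermionTorus 2 (2 * k + 1 + 1))),
      IsGroundStateInSector (hubbardTorus 2 (2 * k + 1 + 1) 1 U) (2 * ⌊(1 - δ) * (((2 * k + 1 + 1) : ℕ) : ℝ) ^ 2 / 2⌋₊) 0 ψ → star ψ ⬝ᵥ ψ = 1 →
        (∑ m ∈ (Finset.univ.filter fun m : Literature.Probability.LatticeModels.TorusSite 2 (2 * k + 1 + 1) =>
            m ≠ 0 ∧ momentumNormSq (2 * k + 1 + 1) m < η ^ 2),
          pairStructureFactor dWaveFormFactor (2 * k + 1 + 1) ψ m) / ((2 * k + 1 + 1 : ℕ) : ℝ) ^ 2 ≤ b)) : (∃ a : ℝ, 0 < a ∧ ∀ᶠ k : ℕ in Filter.atTop, ∀ ψ : Fock (Orb (FermionTorus 2 (2 * k + 1 + 1))),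
    IsGroundStateInSector (hubbardTorus 2 (2 * k + 1 + 1) 1 U) (2 * ⌊(1 - δ) * (((2 * k + 1 + 1) : ℕ) : ℝ) ^ 2 / 2⌋₊) 0 ψ → star ψ ⬝ᵥ ψ = 1 →
      a * ((2 * k + 1 + 1 : ℕ) : ℝ) ^ 4 ≤ (expect ((pairField dWaveFormFactor (2 * k + 1 + 1))ᴴ * pairField dWaveFormFactor (2 * k + 1 + 1)) ψ).re) := by
  obtain ⟨a, ha, hP⟩ := hP
  obtain ⟨η, hη, hIRη⟩ := hIR (a / 4) (by positivity)
  set C : ℝ := ∑ e ∈ insert (0 : Literature.Probability.LatticeModels.Site 2) unitSteps,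
    ‖((dWaveFormFactor e / Real.sqrt 2 : ℝ) : ℂ)‖ * 2 with hC_def
  obtain ⟨R, hR, htail⟩ := exists_blockScale C ha hη
  refine ⟨a / 2, by positivity, ?_⟩
  filter_upwards [hP R hR, hIRη] with k hPk hIRk
  intro ψ hψ hψ1
  have hblock := hPk ψ hψ hψ1
  have hY := re_expect_blockRepulsion (2 * k + 1 + 1) R ψ
  have hleak := hIRk ψ hψ hψ1
  have hfejer :=
    Summit.HubbardSuperconductivity.HubbardSuperconductivity.Theorems.WcbcsSsbToTorusLRO.stub_fejerClosure
      dWaveFormFactor (2 * k + 1 + 1) R hR η hη ψ hψ1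
  have hLpos : (0 : ℝ) < ((2 * k + 1 + 1 : ℕ) : ℝ) := by positivity
  have hRpos : (0 : ℝ) < (R : ℝ) := by exact_mod_cast hR
  have hb : a ≤ (∑ x : Literature.Probability.LatticeModels.TorusSite 2 (2 * k + 1 + 1),
      star ((∑ u : Fin 2 → Fin R, localPair dWaveFormFactor (2 * k + 1 + 1) (x + fun i => ((u i : ℕ) : ZMod (2 * k + 1 + 1)))) *ᵥ ψ) ⬝ᵥ ((∑ u : Fin 2 → Fin R, localPair dWaveFormFactor (2 * k + 1 + 1) (x + fun i => ((u i : ℕ) : ZMod (2 * k + 1 + 1)))) *ᵥ ψ)).re /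
        ((R : ℝ) ^ 4 * ((2 * k + 1 + 1 : ℕ) : ℝ) ^ 2) := by
    rw [le_div_iff₀ (by positivity)]
    rw [hY] at hblock
    have e : ((R : ℝ) ^ 4)⁻¹ * (∑ x : Literature.Probability.LatticeModels.TorusSite 2 (2 * k + 1 + 1),
        star ((∑ u : Fin 2 → Fin R, localPair dWaveFormFactor (2 * k + 1 + 1) (x + fun i => ((u i : ℕ) : ZMod (2 * k + 1 + 1)))) *ᵥ ψ) ⬝ᵥ ((∑ u : Fin 2 → Fin R, localPair dWaveFormFactor (2 * k + 1 + 1) (x + fun i => ((u i : ℕ) : ZMod (2 * k + 1 + 1)))) *ᵥ ψ)).re * (R : ℝ) ^ 4 =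
        (∑ x : Literature.Probability.LatticeModels.TorusSite 2 (2 * k + 1 + 1),
          star ((∑ u : Fin 2 → Fin R, localPair dWaveFormFactor (2 * k + 1 + 1) (x + fun i => ((u i : ℕ) : ZMod (2 * k + 1 + 1)))) *ᵥ ψ) ⬝ᵥ ((∑ u : Fin 2 → Fin R, localPair dWaveFormFactor (2 * k + 1 + 1) (x + fun i => ((u i : ℕ) : ZMod (2 * k + 1 + 1)))) *ᵥ ψ)).re := by
      field_simp
    nlinarith [mul_le_mul_of_nonneg_right hblock (pow_pos hRpos 4).le]
  have hfloor : a / 2 ≤ (expect ((pairField dWaveFormFactor (2 * k + 1 + 1))ᴴ * pairField dWaveFormFactor (2 * k + 1 + 1)) ψ).re / ((2 * k + 1 + 1 : ℕ) : ℝ) ^ 4 := by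
    linarith
  rwa [le_div_iff₀ (by positivity)] at hfloor

/-- **MODULO the infrared leak, derivative face purity IS the summit matrix** at `(U, δ)` (`δ ≥ 0`). [folklore] -/
theorem deriv_iff_hasDWavePairFieldLROAt_of_leak {U δ : ℝ} (hδ : 0 ≤ δ) (hIR : (∀ b : ℝ, 0 < b → ∃ η : ℝ, 0 < η ∧ ∀ᶠ k : ℕ in Filter.atTop,
    ∀ ψ : Fock (Orb (FermionTorus 2 (2 * k + 1 + 1))),
      IsGroundStateInSector (hubbardTorus 2 (2 * k + 1 + 1) 1 U) (2 * ⌊(1 - δ) * (((2 * k + 1 + 1) : ℕ) : ℝ) ^ 2 / 2⌋₊) 0 ψ → star ψ ⬝ᵥ ψ = 1 →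
        (∑ m ∈ (Finset.univ.filter fun m : Literature.Probability.LatticeModels.TorusSite 2 (2 * k + 1 + 1) =>
            m ≠ 0 ∧ momentumNormSq (2 * k + 1 + 1) m < η ^ 2),
          pairStructureFactor dWaveFormFactor (2 * k + 1 + 1) ψ m) / ((2 * k + 1 + 1 : ℕ) : ℝ) ^ 2 ≤ b)) :
    (∃ a : ℝ, 0 < a ∧ ∀ R : ℕ, 0 < R → ∀ᶠ k : ℕ in Filter.atTop,
    ∀ ψ : Fock (Orb (FermionTorus 2 (2 * k + 1 + 1))),
      IsGroundStateInSector (hubbardTorus 2 (2 * k + 1 + 1) 1 U) (2 * ⌊(1 - δ) * (((2 * k + 1 + 1) : ℕ) : ℝ) ^ 2 / 2⌋₊) 0 ψ → star ψ ⬝ᵥ ψ = 1 →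
        a * ((2 * k + 1 + 1 : ℕ) : ℝ) ^ 2 ≤ (star ψ ⬝ᵥ ((((((R : ℝ) ^ 4)⁻¹ : ℝ) : ℂ) • ∑ a : Literature.Probability.LatticeModels.TorusSite 2 (2 * k + 1 + 1), ((∑ u : Fin 2 → Fin R, localPair dWaveFormFactor ((2 * k + 1 + 1)) (a + fun i => ((u i : ℕ) : ZMod ((2 * k + 1 + 1))))))ᴴ * ((∑ u : Fin 2 → Fin R, localPair dWaveFormFactor ((2 * k + 1 + 1)) (a + fun i => ((u i : ℕ) : ZMod ((2 * k + 1 + 1)))))))) *ᵥ ψ).re) ↔ HasDWavePairFieldLROAt U δ :=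
  ⟨fun hP => hasDWavePairFieldLROAt_of_floor (floor_of_deriv_of_leak hP hIR), deriv_of_hasDWavePairFieldLROAt hδ⟩

/-! ### (4) What the chord adds: order-poor states are extensively excited -/

/-- One variational line: `E_K(H + κW) - E_K(H) ≤ (re⟨φ,Hφ⟩ - E_K(H)) + κ re⟨φ,Wφ⟩` for every unit `φ ∈ K`. [folklore] -/
theorem chord_le_excess_add {n : Type*} [Fintype n] (H W : Matrix n n ℂ) (K : Submodule ℂ (n → ℂ)) (κ : ℝ)
    {φ : n → ℂ} (hφK : φ ∈ K) (hφ : star φ ⬝ᵥ φ = 1) :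
    (H + (κ : ℂ) • W).minEnergyOn K - H.minEnergyOn K ≤
      ((star φ ⬝ᵥ H *ᵥ φ).re - H.minEnergyOn K) + κ * (star φ ⬝ᵥ W *ᵥ φ).re := by
  have h1 := minEnergyOn_le_re_rayleigh (H + (κ : ℂ) • W) K hφK hφ
  rw [Matrix.add_mulVec, dotProduct_add, Complex.add_re, Matrix.smul_mulVec, dotProduct_smul, smul_eq_mul,
    Complex.re_ofReal_mul] at h1
  linarith

/-- **The chord's excess: order-poor states are EXTENSIVELY excited.** Under CHORD(U, δ), for every block scale
`R` there is `κ = κ(R) > 0`, independent of the side, such that eventually along even sides every unit vector `φ` of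
the sector `(N_L, S^z = 0)` with block coherence `re⟨φ, W_R φ⟩ ≤ (a/2)L²` has energy
`re⟨φ, H φ⟩ ≥ E_sec(H) + (κa/2)L²`. [folklore] -/
theorem extensiveGap_of_chord {U δ : ℝ} (h : (∃ a : ℝ, 0 < a ∧ ∀ R : ℕ, 0 < R → ∃ κ : ℝ, 0 < κ ∧ ∀ᶠ k : ℕ in Filter.atTop,
    κ * a * ((2 * k + 1 + 1 : ℕ) : ℝ) ^ 2 ≤
      (hubbardTorus 2 (2 * k + 1 + 1) 1 U + (κ : ℂ) • (((((R : ℝ) ^ 4)⁻¹ : ℝ) : ℂ) • ∑ a : Literature.Probability.LatticeModels.TorusSite 2 (2 * k + 1 + 1), ((∑ u : Fin 2 → Fin R, localPair dWaveFormFactor ((2 * k + 1 + 1)) (a + fun i => ((u i : ℕ) : ZMod ((2 * k + 1 + 1))))))ᴴ * ((∑ u : Fin 2 → Fin R, localPair dWaveFormFactor ((2 * k + 1 + 1)) (a + fun i => ((u i : ℕ) : ZMod ((2 * k + 1 + 1)))))))).minEnergyOn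
          (szSector (2 * ⌊(1 - δ) * (((2 * k + 1 + 1) : ℕ) : ℝ) ^ 2 / 2⌋₊) 0) -
        (hubbardTorus 2 (2 * k + 1 + 1) 1 U).minEnergyOn (szSector (2 * ⌊(1 - δ) * (((2 * k + 1 + 1) : ℕ) : ℝ) ^ 2 / 2⌋₊) 0))) :
    ∃ a : ℝ, 0 < a ∧ ∀ R : ℕ, 0 < R → ∃ κ : ℝ, 0 < κ ∧ ∀ᶠ k : ℕ in atTop,
      ∀ φ : Fock (Orb (FermionTorus 2 (2 * k + 1 + 1))),
        φ ∈ szSector (Λ := FermionTorus 2 (2 * k + 1 + 1)) (2 * ⌊(1 - δ) * (((2 * k + 1 + 1) : ℕ) : ℝ) ^ 2 / 2⌋₊) 0 → star φ ⬝ᵥ φ = 1 →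
        (star φ ⬝ᵥ (((((R : ℝ) ^ 4)⁻¹ : ℝ) : ℂ) • ∑ a : Literature.Probability.LatticeModels.TorusSite 2 (2 * k + 1 + 1), ((∑ u : Fin 2 → Fin R, localPair dWaveFormFactor ((2 * k + 1 + 1)) (a + fun i => ((u i : ℕ) : ZMod ((2 * k + 1 + 1))))))ᴴ * ((∑ u : Fin 2 → Fin R, localPair dWaveFormFactor ((2 * k + 1 + 1)) (a + fun i => ((u i : ℕ) : ZMod ((2 * k + 1 + 1))))))) *ᵥ φ).re ≤ a / 2 * ((2 * k + 1 + 1 : ℕ) : ℝ) ^ 2 →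
          (hubbardTorus 2 (2 * k + 1 + 1) 1 U).minEnergyOn (szSector (2 * ⌊(1 - δ) * (((2 * k + 1 + 1) : ℕ) : ℝ) ^ 2 / 2⌋₊) 0) +
              κ * (a / 2) * ((2 * k + 1 + 1 : ℕ) : ℝ) ^ 2 ≤
            (star φ ⬝ᵥ hubbardTorus 2 (2 * k + 1 + 1) 1 U *ᵥ φ).re := by
  obtain ⟨a, ha, h⟩ := h
  refine ⟨a, ha, fun R hR => ?_⟩
  obtain ⟨κ, hκ, hk⟩ := h R hR
  refine ⟨κ, hκ, ?_⟩
  filter_upwards [hk] with k hk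
  intro φ hφK hφ hpoor
  have hvar := chord_le_excess_add (hubbardTorus 2 (2 * k + 1 + 1) 1 U) ((((((R : ℝ) ^ 4)⁻¹ : ℝ) : ℂ) • ∑ a : Literature.Probability.LatticeModels.TorusSite 2 (2 * k + 1 + 1), ((∑ u : Fin 2 → Fin R, localPair dWaveFormFactor ((2 * k + 1 + 1)) (a + fun i => ((u i : ℕ) : ZMod ((2 * k + 1 + 1))))))ᴴ * ((∑ u : Fin 2 → Fin R, localPair dWaveFormFactor ((2 * k + 1 + 1)) (a + fun i => ((u i : ℕ) : ZMod ((2 * k + 1 + 1))))))))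
    (szSector (2 * ⌊(1 - δ) * (((2 * k + 1 + 1) : ℕ) : ℝ) ^ 2 / 2⌋₊) 0) κ hφK hφ
  nlinarith [mul_le_mul_of_nonneg_left hpoor hκ.le]

/-! ### Packaging on the registered signature -/

/-- The registered stub yields `crux hypotheses → DERIVATIVE(U, δ)`; with the leak at `(U, δ)` that is the crux body
itself (`deriv_iff_hasDWavePairFieldLROAt_of_leak`), so any proof of the stub proves the crux's conclusion in
passing, and then some (`extensiveGap_of_chord`). [folklore] -/
theorem stub_gives_deriv
    (h : ∃ U₀ : ℝ, 0 < U₀ ∧ ∀ U ∈ Set.Ioo (0:ℝ) U₀, ∀ δ ∈ Set.Ioo (0:ℝ) (1 / 2), ∀ μ : ℝ, Filter.Tendsto (fun L : ℕ => ((hubbardTorusWith 2 (L + 1) 1 U μ).groundStateFunctional totalNumber).re / ((L + 1 : ℕ) : ℝ) ^ 2) Filter.atTop (nhds (1 - δ)) → HasDWaveOrder U μ → ∃ a : ℝ, 0 < a ∧ ∀ R : ℕ, 0 < R → ∃ κ : ℝ, 0 < κ ∧ ∀ᶠ k : ℕ in Filter.atTop, κ * a * ((2 * k + 1 + 1 :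 ℕ) : ℝ) ^ 2 ≤ (hubbardTorus 2 (2 * k + 1 + 1) 1 U + (κ : ℂ) • ((((R : ℝ) ^ 4)⁻¹ : ℝ) : ℂ) • ∑ a : Literature.Probability.LatticeModels.TorusSite 2 (2 * k + 1 + 1), (∑ u : Fin 2 → Fin R, localPair dWaveFormFactor (2 * k + 1 + 1) (a + fun i => ((u i : ℕ) : ZMod (2 * k + 1 + 1))))ᴴ * (∑ u : Fin 2 → Fin R, localPair dWaveFormFactor (2 * k + 1 + 1) (a + fun i => ((u i : ℕ) : ZMod (2 * k + 1 + 1))))).minEnergyOn (szSector (2 * ⌊(1 - δ) * ((2 * k + 1 + 1 : ℕ) : ℝ) ^ 2 / 2⌋₊) 0) - (hubbardTorus 2 (2 * k + 1 + 1) 1 U).minEnergyOn (szSector (2 * ⌊(1 - δ) * ((2 * k + 1 + 1 : ℕ) : ℝ) ^ 2 / 2⌋₊) 0)) :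
    ∃ U₀ : ℝ, 0 < U₀ ∧ ∀ U ∈ Set.Ioo (0:ℝ) U₀, ∀ δ ∈ Set.Ioo (0:ℝ) (1 / 2), ∀ μ : ℝ,
      Filter.Tendsto (fun L : ℕ => ((hubbardTorusWith 2 (L + 1) 1 U μ).groundStateFunctional totalNumber).re /
        ((L + 1 : ℕ) : ℝ) ^ 2) Filter.atTop (nhds (1 - δ)) → HasDWaveOrder U μ → (∃ a : ℝ, 0 < a ∧ ∀ R : ℕ, 0 < R → ∀ᶠ k : ℕ in Filter.atTop,
    ∀ ψ : Fock (Orb (FermionTorus 2 (2 * k + 1 + 1))),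
      IsGroundStateInSector (hubbardTorus 2 (2 * k + 1 + 1) 1 U) (2 * ⌊(1 - δ) * (((2 * k + 1 + 1) : ℕ) : ℝ) ^ 2 / 2⌋₊) 0 ψ → star ψ ⬝ᵥ ψ = 1 →
        a * ((2 * k + 1 + 1 : ℕ) : ℝ) ^ 2 ≤ (star ψ ⬝ᵥ ((((((R : ℝ) ^ 4)⁻¹ : ℝ) : ℂ) • ∑ a : Literature.Probability.LatticeModels.TorusSite 2 (2 * k + 1 + 1), ((∑ u : Fin 2 → Fin R, localPair dWaveFormFactor ((2 * k + 1 + 1)) (a + fun i => ((u i : ℕ) : ZMod ((2 * k + 1 + 1))))))ᴴ * ((∑ u : Fin 2 → Fin R, localPair dWaveFormFactor ((2 * k + 1 + 1)) (a + fun i => ((u i : ℕ) : ZMod ((2 * k + 1 + 1)))))))) *ᵥ ψ).re) := by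
  obtain ⟨U₀, hU₀, h⟩ := stubFacePurityChord_iff.1 h
  exact ⟨U₀, hU₀, fun U hU δ hδ μ hdm hord => deriv_of_chord (h U hU δ hδ μ hdm hord)⟩

end Summit.HubbardSuperconductivity.WcbcsSsbToTorusLRO.Negative

end
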